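import Summits.QuantumFields.BalabanUV.Beta.GAN24.TransverseProjector
import Summits.QuantumFields.BalabanUV.Beta.GAN24.FibreSymbols
import Literature.MathematicalPhysics.QuantumFieldTheory.Balaban1983to89.B4Strip

/-!
# `BalabanUV.Beta.GAN24.FibreBlockBounds` — binder row G-an2-4 / (CONV-C), road P1-fibre, node N05 (BOUNDS half) of `SKELETON-P1.md` §8 =
# step A3 `T_inv_bound` of §3: norm bounds for the explicit per-fine-momentum solution `FibreBlockSolve.Asol` / `musol` of one block `T(k)`
# (table row P1-N05b of `LEMMAS.md` § GAN24 SKELETON-P1, self-row of leaf seat `b2b-balaban-gan24-formalise-leaf-11`)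

NOT IN PRINT; OUR PROOF ATTEMPT.  HONEST FRAMING (cell contract, verbatim): «discharging `BetaPertH` makes Bałaban's UV stability UNCONDITIONAL — a real
constructive-QFT result; it is NOT the continuum limit and NOT the Clay problem.»  HONEST DEPENDENCY (verbatim): «continuum YM on T⁴ ⇐ BetaPertH ∧ nine spine
estimates (0/9 proved); BetaPertH ⇐ (D1) ∧ (D4) ∧ CAP+tail; G-an2-4 gates asym, D1 and NE2/3/4.»  [folklore] finite-dimensional norm inequalities over `ℂ`
(no cited fact, no definition, no wall binder).  NOT summit progress; discharges nothing of the K-slot `ConvCKWall 3 Lc` by itself.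

## What is proved (generic dimension `D`; vocabulary of `GAN24/FibreBlockSolve` and `GAN24/TransverseProjector`, imported BY NAME)
`FibreBlockSolve` (row P1-L02) solves one diagonal block of the Bloch fibre matrix EXPLICITLY — `Asol ∂ ∂♭ g L cc = Π⊥g/(2L) + (cc/L²)∂`
(`TransverseProjector.Asol_eq_projT`, `projT ∂ ∂♭ L g = g − (∂♭·g/L)∂`, row P1-L08a), `musol ∂♭ g L = −(∂♭·g)/L²`, with `dot u v = Σ_κ u_κ v_κ` and the block datum
`dot ∂♭ ∂ = L ≠ 0`.  Step A3 of `SKELETON-P1.md` asks for the SIZE of `T(k)⁻¹`: «`‖T(k)⁻¹‖ ≤ C (|∂̂(k)|⁻² + |∂̂(k)|⁻⁴)` entrywise, transverse block `≤ C|∂̂|⁻²`».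
This file supplies, in that currency (`‖v‖₂ := √(Σ_κ ‖v_κ‖²)` written out, no new definition):
* §1 `norm_dot_le` (Cauchy–Schwarz `‖u·v‖ ≤ ‖u‖₂‖v‖₂`), `sqrt_sum_sq_le_sqrt_card_mul_norm` (`‖v‖₂ ≤ √D·‖v‖_∞`), and LINEARITY of `Asol`, `musol` in the feeds
  `(g, cc)` (`Asol_add`, `Asol_smul`, `Asol_zero`, `musol_add`, `musol_smul`, `musol_zero`);
* §2 GENERAL complex block data (any `k`, e.g. on a complex strip; nothing assumed): `norm_projT_le` (`‖(Π⊥g)_κ‖ ≤ ‖g_κ‖ + ‖∂♭·g‖‖∂_κ‖/‖L‖`), the entrywise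
  triangle bound `norm_Asol_le` (`‖Asol_κ‖ ≤ ‖(Π⊥g)_κ‖/(2‖L‖) + ‖cc‖‖∂_κ‖/‖L‖²`), `norm_musol` (`‖musol‖ = ‖∂♭·g‖/‖L‖²`), `norm_dot_Asol` (`‖∂♭·Asol‖ = ‖cc‖/‖L‖`);
* §3 the REAL ZONE, abstractly: `∂♭_κ = conj ∂_κ` for all `κ` and `dot ∂♭ ∂ = L` (then `L = Σ_κ ‖∂_κ‖²`: `L_eq_sum_sq`, `norm_L`): `Π⊥` is an ORTHOGONAL projection —
  Pythagoras `sum_sq_add_of_dot_eq_zero` (`∂♭·t = 0 ⇒ Σ‖t_κ + c∂_κ‖² = Σ‖t_κ‖² + ‖c‖²Σ‖∂_κ‖²`), Bessel `sum_sq_eq_projT_add` (`Σ‖g_κ‖² = Σ‖(Π⊥g)_κ‖² + ‖∂♭·g‖²/‖L‖`),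
  hence the contraction `sum_sq_projT_le`, `sq_norm_dot_le`, `norm_projT_le_real`; for the block solution the `ℓ²` PYTHAGORAS **`sum_sq_Asol_eq`**
  (`Σ‖Asol_κ‖² = Σ‖(Π⊥g)_κ‖²/(4‖L‖²) + ‖cc‖²/‖L‖³` — transverse and gauge parts are orthogonal), **`sum_sq_Asol_le`** (`≤ Σ‖g_κ‖²/(4‖L‖²) + ‖cc‖²/‖L‖³`),
  the transverse-block operator bound `sum_sq_Asol_transverse_le` (`Σ‖Asol_κ − (cc/L²)∂_κ‖² ≤ Σ‖g‖²/(4‖L‖²)`: the block is `≤ (2|∂̂|²)⁻¹` on `ℓ²`), the entrywise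
  bounds `norm_Asol_le_real` (`‖Asol_κ‖ ≤ ‖g‖₂/(2‖L‖) + ‖cc‖‖∂_κ‖/‖L‖²`), `norm_Asol_le_real'` (`… + ‖cc‖/(‖L‖√‖L‖)`), and the multiplier bounds `norm_musol_le_real`
  (`‖musol‖ ≤ ‖g‖₂/(‖L‖√‖L‖)`), `sq_norm_musol_mul_le` (`‖musol‖²‖L‖³ ≤ ‖g‖₂²`, square-root free) — the `|∂̂|⁻²` (transverse) and `|∂̂|⁻³ ≤ |∂̂|⁻² + |∂̂|⁻⁴`
  (gauge column / multiplier row) entries of A3;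
* §4 the `FibreSymbols` instance: for a self-conjugate momentum `k` (`∀ κ, conj (k κ) = k κ`; e.g. `B4Strip.ofRealVec p`, `conj_ofRealVec`):
  `dflat k κ = conj (dhat k κ)` (`dflat_eq_conj_dhat`), `dot (dflat k) (dhat k) = lapSym k` (`dot_dflat_dhat`, every `k`), `lapSym k = Σ‖dhat k κ‖²`
  (`lapSym_eq_sum_sq`, `norm_lapSym`), `norm_dhat_le_sqrt`, and §3 instantiated at `(dhat k, dflat k, lapSym k)`:
  `sum_sq_Asol_symbol_le`, `norm_Asol_symbol_le`, `norm_musol_symbol_le`, `norm_dot_Asol_symbol`.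
NOT treated here (other rows of the table, imported or left to their owners): the `4 sin²` / Taylor forms and two-sided bounds of `lapSym ∘ ofRealVec` and the
projector-Lipschitz rate (row P1-L07: `GAN24/SymbolTaylor`, `GAN24/SymbolProjector`), the alias weights (P1-L06), the projector ALGEBRA and the `m = 0` cancellation
(P1-L08a `GAN24/TransverseProjector`, used here by name), the Gaffney identity (P1-N08).  A parallel unclaimed draft of the same node by seat
`b2b-balaban-gan24-formalise-leaf-08` (g4; `nsq`-currency, CLAIMS.log 2026-08-19T23:33:56Z) informed the `ℓ²` Pythagoras form `sum_sq_Asol_eq`.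
-/

noncomputable section

open Finset Complex
open scoped BigOperators ComplexConjugate
open Summit.QuantumFields.BalabanUV.Beta.GAN24.FibreBlockSolve (dot dot_add_right dot_smul_right Asol musol dot_Asol)
open Summit.QuantumFields.BalabanUV.Beta.GAN24.TransverseProjector (projT projT_apply dot_db_projT Asol_eq_projT)
open Summit.QuantumFields.BalabanUV.Beta.GAN24.FibreSymbols (dhat dflat lapSym)
open Literature.MathematicalPhysics.QuantumFieldTheory.Balaban1983to89.B4Strip (ofRealVec)

namespace Summit.QuantumFields.BalabanUV.Beta.GAN24.FibreBlockBounds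

variable {D : ℕ}

/-! ### §1. Cauchy–Schwarz for `dot`; linearity of the block solution in its feeds -/

/-- [folklore] Cauchy–Schwarz for the bilinear pairing `dot u v = Σ_κ u_κ v_κ` on `ℂ^D`: `‖u·v‖ ≤ ‖u‖₂ ‖v‖₂`. -/
theorem norm_dot_le (u v : Fin D → ℂ) :
    ‖dot u v‖ ≤ Real.sqrt (∑ κ, ‖u κ‖ ^ 2) * Real.sqrt (∑ κ, ‖v κ‖ ^ 2) := by
  have h1 : ‖dot u v‖ ≤ ∑ κ, ‖u κ‖ * ‖v κ‖ := by
    unfold dot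
    refine (norm_sum_le _ _).trans (le_of_eq ?_)
    exact Finset.sum_congr rfl fun κ _ => norm_mul _ _
  have h2 : (∑ κ, ‖u κ‖ * ‖v κ‖) ^ 2 ≤ (∑ κ, ‖u κ‖ ^ 2) * (∑ κ, ‖v κ‖ ^ 2) :=
    Finset.sum_mul_sq_le_sq_mul_sq _ _ _
  have h3 : ∑ κ, ‖u κ‖ * ‖v κ‖ ≤ Real.sqrt (∑ κ, ‖u κ‖ ^ 2) * Real.sqrt (∑ κ, ‖v κ‖ ^ 2) := by
    rw [← Real.sqrt_mul (Finset.sum_nonneg fun κ _ => sq_nonneg _)]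
    exact (le_abs_self _).trans (Real.abs_le_sqrt h2)
  exact h1.trans h3

/-- [folklore] `ℓ² ≤ √D · ℓ^∞`: the Euclidean size of a vector is at most `√D` times its sup norm (to convert the `ℓ²` bounds below into
`‖·‖_∞` bounds when wanted). -/
theorem sqrt_sum_sq_le_sqrt_card_mul_norm (g : Fin D → ℂ) :
    Real.sqrt (∑ κ, ‖g κ‖ ^ 2) ≤ Real.sqrt D * ‖g‖ := by
  have h : ∑ κ, ‖g κ‖ ^ 2 ≤ (D : ℝ) * ‖g‖ ^ 2 := by
    calc ∑ κ, ‖g κ‖ ^ 2 ≤ ∑ _κ : Fin D, ‖g‖ ^ 2 :=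
          Finset.sum_le_sum fun κ _ => pow_le_pow_left₀ (norm_nonneg _) (norm_le_pi_norm g κ) 2
      _ = (D : ℝ) * ‖g‖ ^ 2 := by rw [Finset.sum_const, Finset.card_univ, Fintype.card_fin, nsmul_eq_mul]
  calc Real.sqrt (∑ κ, ‖g κ‖ ^ 2) ≤ Real.sqrt ((D : ℝ) * ‖g‖ ^ 2) := Real.sqrt_le_sqrt h
    _ = Real.sqrt D * ‖g‖ := by rw [Real.sqrt_mul (Nat.cast_nonneg _), Real.sqrt_sq (norm_nonneg _)]

/-- [folklore] `Asol` is ADDITIVE in the pair of feeds `(g, cc)` (superposition of sources). -/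
theorem Asol_add (dd db g g' : Fin D → ℂ) (L cc cc' : ℂ) :
    Asol dd db (g + g') L (cc + cc') = Asol dd db g L cc + Asol dd db g' L cc' := by
  funext κ
  simp only [Asol, Pi.add_apply, dot_add_right]
  ring

/-- [folklore] `Asol` is HOMOGENEOUS in the pair of feeds `(g, cc)`. -/
theorem Asol_smul (dd db g : Fin D → ℂ) (L cc a : ℂ) :
    Asol dd db (a • g) L (a * cc) = a • Asol dd db g L cc := by
  funext κ
  have e : a • g = fun l => a * g l := rfl
  simp only [e, Asol, Pi.smul_apply, smul_eq_mul, dot_smul_right]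
  ring

/-- [folklore] No feed, no response: `Asol ∂ ∂♭ 0 L 0 = 0`. -/
theorem Asol_zero (dd db : Fin D → ℂ) (L : ℂ) : Asol dd db 0 L 0 = 0 := by
  funext κ
  simp [Asol, dot]

/-- [folklore] `musol` is ADDITIVE in the feed `g`. -/
theorem musol_add (db g g' : Fin D → ℂ) (L : ℂ) : musol db (g + g') L = musol db g L + musol db g' L := by
  simp only [musol, dot_add_right]
  ring

/-- [folklore] `musol` is HOMOGENEOUS in the feed `g`. -/
theorem musol_smul (db g : Fin D → ℂ) (L a : ℂ) : musol db (a • g) L = a * musol db g L := by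
  have e : a • g = fun l => a * g l := rfl
  simp only [e, musol, dot_smul_right]
  ring

/-- [folklore] `musol ∂♭ 0 L = 0`. -/
theorem musol_zero (db : Fin D → ℂ) (L : ℂ) : musol db 0 L = 0 := by
  simp [musol, dot]

/-! ### §2. General complex block data: triangle bounds (no reality assumed) -/

/-- [folklore] ENTRYWISE TRIANGLE BOUND for the transverse part, arbitrary complex data: `‖(Π⊥g)_κ‖ ≤ ‖g_κ‖ + ‖∂♭·g‖·‖∂_κ‖/‖L‖`. -/
theorem norm_projT_le (dd db g : Fin D → ℂ) (L : ℂ) (κ : Fin D) :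
    ‖projT dd db L g κ‖ ≤ ‖g κ‖ + ‖dot db g‖ / ‖L‖ * ‖dd κ‖ := by
  rw [projT_apply]
  refine (norm_sub_le _ _).trans (le_of_eq ?_)
  rw [norm_mul, norm_div]

/-- [folklore] ENTRYWISE TRIANGLE BOUND for the field solution, arbitrary complex data (in particular at complex momenta):
`‖Asol_κ‖ ≤ ‖(Π⊥g)_κ‖/(2‖L‖) + ‖cc‖·‖∂_κ‖/‖L‖²`. -/
theorem norm_Asol_le (dd db g : Fin D → ℂ) (L cc : ℂ) (κ : Fin D) :
    ‖Asol dd db g L cc κ‖ ≤ ‖projT dd db L g κ‖ / (2 * ‖L‖) + ‖cc‖ * ‖dd κ‖ / ‖L‖ ^ 2 := by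
  rw [Asol_eq_projT]
  refine (norm_add_le _ _).trans (le_of_eq ?_)
  rw [norm_div, norm_mul, Complex.norm_two, norm_mul, norm_div, norm_pow]
  ring

/-- [folklore] SIZE OF THE GAUGE MULTIPLIER: `‖musol‖ = ‖∂♭·g‖/‖L‖²` (any complex data). -/
theorem norm_musol (db g : Fin D → ℂ) (L : ℂ) : ‖musol db g L‖ = ‖dot db g‖ / ‖L‖ ^ 2 := by
  simp only [musol, norm_div, norm_neg, norm_pow]

/-- [folklore] SIZE OF THE LONGITUDINAL CONTENT of the field solution: `‖∂♭·Asol‖ = ‖cc‖/‖L‖` (from `FibreBlockSolve.dot_Asol`; any complex data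
with `dot ∂♭ ∂ = L ≠ 0`). -/
theorem norm_dot_Asol (dd db g : Fin D → ℂ) {L : ℂ} (hL0 : L ≠ 0) (hL : dot db dd = L) (cc : ℂ) :
    ‖dot db (Asol dd db g L cc)‖ = ‖cc‖ / ‖L‖ := by
  rw [dot_Asol dd db g hL0 hL cc, norm_div]

/-! ### §3. The real zone: `∂♭ = conj ∂`, `L = ∂♭·∂ = Σ‖∂_κ‖²` — the transverse projector is orthogonal -/

section RealZone

variable {dd db : Fin D → ℂ} {L : ℂ}

/-- [folklore] In the real zone the block datum is the squared Euclidean length of the difference symbol: `L = Σ_κ ‖∂_κ‖²`. -/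
theorem L_eq_sum_sq (hdb : ∀ κ, db κ = conj (dd κ)) (hL : dot db dd = L) :
    L = ((∑ κ, ‖dd κ‖ ^ 2 : ℝ) : ℂ) := by
  rw [← hL]
  unfold dot
  push_cast
  refine Finset.sum_congr rfl fun κ _ => ?_
  rw [hdb κ, ← Complex.normSq_eq_conj_mul_self, Complex.normSq_eq_norm_sq]
  push_cast
  rfl

/-- [folklore] `‖L‖ = Σ_κ ‖∂_κ‖²` in the real zone. -/
theorem norm_L (hdb : ∀ κ, db κ = conj (dd κ)) (hL : dot db dd = L) : ‖L‖ = ∑ κ, ‖dd κ‖ ^ 2 := by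
  rw [L_eq_sum_sq hdb hL, Complex.norm_real, Real.norm_of_nonneg (Finset.sum_nonneg fun κ _ => sq_nonneg _)]

/-- [folklore] The reflected symbol has the same Euclidean length: `Σ‖∂♭_κ‖² = Σ‖∂_κ‖²`. -/
theorem sum_sq_db (hdb : ∀ κ, db κ = conj (dd κ)) : ∑ κ, ‖db κ‖ ^ 2 = ∑ κ, ‖dd κ‖ ^ 2 :=
  Finset.sum_congr rfl fun κ _ => by rw [hdb κ, RCLike.norm_conj]

/-- [folklore] Each component of the difference symbol is at most `√‖L‖`. -/
theorem norm_dd_le_sqrt (hdb : ∀ κ, db κ = conj (dd κ)) (hL : dot db dd = L) (κ : Fin D) :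
    ‖dd κ‖ ≤ Real.sqrt ‖L‖ := by
  rw [norm_L hdb hL]
  refine (le_abs_self _).trans (Real.abs_le_sqrt ?_)
  exact Finset.single_le_sum (f := fun l => ‖dd l‖ ^ 2) (fun l _ => sq_nonneg _) (Finset.mem_univ κ)

/-- [folklore] Cauchy–Schwarz against the reflected symbol: `‖∂♭·g‖ ≤ √‖L‖ · ‖g‖₂`. -/
theorem norm_dot_le_real (hdb : ∀ κ, db κ = conj (dd κ)) (hL : dot db dd = L) (g : Fin D → ℂ) :
    ‖dot db g‖ ≤ Real.sqrt ‖L‖ * Real.sqrt (∑ κ, ‖g κ‖ ^ 2) := by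
  have h := norm_dot_le db g
  rwa [sum_sq_db hdb, ← norm_L hdb hL] at h

/-- [folklore] PYTHAGORAS for a splitting `t + c·∂` with `∂♭·t = 0` in the real zone: `Σ‖t_κ + c ∂_κ‖² = Σ‖t_κ‖² + ‖c‖² Σ‖∂_κ‖²`. -/
theorem sum_sq_add_of_dot_eq_zero (hdb : ∀ κ, db κ = conj (dd κ)) (t : Fin D → ℂ) (c : ℂ) (ht : dot db t = 0) :
    ∑ κ, ‖t κ + c * dd κ‖ ^ 2 = ∑ κ, ‖t κ‖ ^ 2 + ‖c‖ ^ 2 * ∑ κ, ‖dd κ‖ ^ 2 := by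
  have hcross : ∑ κ, t κ * conj (c * dd κ) = 0 := by
    have e : ∀ κ, t κ * conj (c * dd κ) = conj c * (db κ * t κ) := fun κ => by
      rw [map_mul, hdb κ]
      ring
    rw [Finset.sum_congr rfl fun κ _ => e κ, ← Finset.mul_sum]
    change conj c * dot db t = 0
    rw [ht, mul_zero]
  calc ∑ κ, ‖t κ + c * dd κ‖ ^ 2
      = ∑ κ, (‖t κ‖ ^ 2 + ‖c * dd κ‖ ^ 2 + 2 * (t κ * conj (c * dd κ)).re) := by
        refine Finset.sum_congr rfl fun κ _ => ?_
        rw [← Complex.normSq_eq_norm_sq, ← Complex.normSq_eq_norm_sq, ← Complex.normSq_eq_norm_sq]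
        exact Complex.normSq_add _ _
    _ = ∑ κ, ‖t κ‖ ^ 2 + ∑ κ, ‖c * dd κ‖ ^ 2 + 2 * (∑ κ, t κ * conj (c * dd κ)).re := by
        rw [Finset.sum_add_distrib, Finset.sum_add_distrib, Complex.re_sum, Finset.mul_sum]
    _ = ∑ κ, ‖t κ‖ ^ 2 + ‖c‖ ^ 2 * ∑ κ, ‖dd κ‖ ^ 2 := by
        rw [hcross, Complex.zero_re, mul_zero, add_zero, Finset.mul_sum]
        congr 1
        exact Finset.sum_congr rfl fun κ _ => by rw [norm_mul, mul_pow]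

/-- [folklore] **BESSEL / TRANSVERSE PYTHAGORAS**: `Σ_κ ‖g_κ‖² = Σ_κ ‖(Π⊥g)_κ‖² + ‖∂♭·g‖²/‖L‖` — the Helmholtz splitting
`g = Π⊥g + (∂♭·g/L)∂` (`TransverseProjector.self_eq_projT_add`) is ORTHOGONAL in the real zone. -/
theorem sum_sq_eq_projT_add (hdb : ∀ κ, db κ = conj (dd κ)) (hL : dot db dd = L) (hL0 : L ≠ 0) (g : Fin D → ℂ) :
    ∑ κ, ‖g κ‖ ^ 2 = ∑ κ, ‖projT dd db L g κ‖ ^ 2 + ‖dot db g‖ ^ 2 / ‖L‖ := by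
  have key := sum_sq_add_of_dot_eq_zero hdb (projT dd db L g) (dot db g / L) (dot_db_projT dd db hL0 hL g)
  have hL' : ‖L‖ ≠ 0 := norm_ne_zero_iff.mpr hL0
  calc ∑ κ, ‖g κ‖ ^ 2 = ∑ κ, ‖projT dd db L g κ + dot db g / L * dd κ‖ ^ 2 :=
        Finset.sum_congr rfl fun κ _ => by rw [projT_apply, sub_add_cancel]
    _ = ∑ κ, ‖projT dd db L g κ‖ ^ 2 + ‖dot db g / L‖ ^ 2 * ∑ κ, ‖dd κ‖ ^ 2 := key
    _ = ∑ κ, ‖projT dd db L g κ‖ ^ 2 + ‖dot db g‖ ^ 2 / ‖L‖ := by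
        rw [← norm_L hdb hL, norm_div, div_pow, sq ‖L‖, div_mul_eq_mul_div, mul_div_mul_right _ _ hL']

/-- [folklore] **THE TRANSVERSE PROJECTOR IS A CONTRACTION** (`ℓ²`): `Σ_κ ‖(Π⊥g)_κ‖² ≤ Σ_κ ‖g_κ‖²`. -/
theorem sum_sq_projT_le (hdb : ∀ κ, db κ = conj (dd κ)) (hL : dot db dd = L) (hL0 : L ≠ 0) (g : Fin D → ℂ) :
    ∑ κ, ‖projT dd db L g κ‖ ^ 2 ≤ ∑ κ, ‖g κ‖ ^ 2 := by
  rw [sum_sq_eq_projT_add hdb hL hL0 g]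
  exact le_add_of_nonneg_right (div_nonneg (sq_nonneg _) (norm_nonneg _))

/-- [folklore] … and the longitudinal coefficient is bounded too: `‖∂♭·g‖²/‖L‖ ≤ Σ‖g_κ‖²`. -/
theorem sq_norm_dot_le (hdb : ∀ κ, db κ = conj (dd κ)) (hL : dot db dd = L) (hL0 : L ≠ 0) (g : Fin D → ℂ) :
    ‖dot db g‖ ^ 2 / ‖L‖ ≤ ∑ κ, ‖g κ‖ ^ 2 := by
  rw [sum_sq_eq_projT_add hdb hL hL0 g]
  exact le_add_of_nonneg_left (Finset.sum_nonneg fun κ _ => sq_nonneg _)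

/-- [folklore] ENTRYWISE: each component of the transverse part is at most `‖g‖₂`. -/
theorem norm_projT_le_real (hdb : ∀ κ, db κ = conj (dd κ)) (hL : dot db dd = L) (hL0 : L ≠ 0) (g : Fin D → ℂ) (κ : Fin D) :
    ‖projT dd db L g κ‖ ≤ Real.sqrt (∑ l, ‖g l‖ ^ 2) := by
  refine (le_abs_self _).trans (Real.abs_le_sqrt ?_)
  refine le_trans ?_ (sum_sq_projT_le hdb hL hL0 g)
  exact Finset.single_le_sum (f := fun l => ‖projT dd db L g l‖ ^ 2) (fun l _ => sq_nonneg _) (Finset.mem_univ κ)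

/-- [folklore] **A3, `ℓ²` PYTHAGORAS FOR THE BLOCK SOLUTION**: `Σ_κ ‖Asol_κ‖² = Σ_κ‖(Π⊥g)_κ‖²/(4‖L‖²) + ‖cc‖²/‖L‖³` — the transverse response and the
pure-gauge response are orthogonal in the real zone. -/
theorem sum_sq_Asol_eq (hdb : ∀ κ, db κ = conj (dd κ)) (hL : dot db dd = L) (hL0 : L ≠ 0) (g : Fin D → ℂ) (cc : ℂ) :
    ∑ κ, ‖Asol dd db g L cc κ‖ ^ 2 = (∑ κ, ‖projT dd db L g κ‖ ^ 2) / (4 * ‖L‖ ^ 2) + ‖cc‖ ^ 2 / ‖L‖ ^ 3 := by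
  have hL' : ‖L‖ ≠ 0 := norm_ne_zero_iff.mpr hL0
  have ht : dot db (fun κ => 1 / (2 * L) * projT dd db L g κ) = 0 := by
    rw [dot_smul_right, dot_db_projT dd db hL0 hL g, mul_zero]
  have key := sum_sq_add_of_dot_eq_zero hdb (fun κ => 1 / (2 * L) * projT dd db L g κ) (cc / L ^ 2) ht
  have e1 : ∀ κ, Asol dd db g L cc κ = 1 / (2 * L) * projT dd db L g κ + cc / L ^ 2 * dd κ := fun κ => by
    rw [Asol_eq_projT]
    ring
  have e2 : ∀ κ, ‖1 / (2 * L) * projT dd db L g κ‖ ^ 2 = ‖projT dd db L g κ‖ ^ 2 / (4 * ‖L‖ ^ 2) := fun κ => by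
    rw [norm_mul, norm_div, norm_one, norm_mul, Complex.norm_two]
    ring
  rw [Finset.sum_congr rfl fun κ _ => by rw [e1 κ], key, Finset.sum_congr rfl fun κ _ => e2 κ, ← Finset.sum_div,
    ← norm_L hdb hL, norm_div, norm_pow, div_pow, ← pow_mul, div_mul_eq_mul_div,
    show ‖L‖ ^ (2 * 2) = ‖L‖ ^ 3 * ‖L‖ by ring, mul_div_mul_right _ _ hL']

/-- [folklore] **A3, `ℓ² → ℓ²`**: `Σ_κ ‖Asol_κ‖² ≤ Σ_κ‖g_κ‖²/(4‖L‖²) + ‖cc‖²/‖L‖³`, i.e. `‖Asol‖₂ ≤ ‖g‖₂/(2|∂̂|²) + |cc|/|∂̂|³`. -/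
theorem sum_sq_Asol_le (hdb : ∀ κ, db κ = conj (dd κ)) (hL : dot db dd = L) (hL0 : L ≠ 0) (g : Fin D → ℂ) (cc : ℂ) :
    ∑ κ, ‖Asol dd db g L cc κ‖ ^ 2 ≤ (∑ κ, ‖g κ‖ ^ 2) / (4 * ‖L‖ ^ 2) + ‖cc‖ ^ 2 / ‖L‖ ^ 3 := by
  rw [sum_sq_Asol_eq hdb hL hL0 g cc]
  exact add_le_add (div_le_div_of_nonneg_right (sum_sq_projT_le hdb hL hL0 g) (by positivity)) le_rfl

/-- [folklore] **A3, TRANSVERSE BLOCK (`ℓ² → ℓ²`)**: `Σ_κ ‖Asol_κ − (cc/L²)∂_κ‖² ≤ Σ‖g_κ‖²/(4‖L‖²)` — the transverse part of the block inverse,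
`Π⊥/(2L)`, is bounded by `(2|∂̂|²)⁻¹` as an operator on `ℓ²(Fin D)`. -/
theorem sum_sq_Asol_transverse_le (hdb : ∀ κ, db κ = conj (dd κ)) (hL : dot db dd = L) (hL0 : L ≠ 0) (g : Fin D → ℂ) (cc : ℂ) :
    ∑ κ, ‖Asol dd db g L cc κ - cc / L ^ 2 * dd κ‖ ^ 2 ≤ (∑ κ, ‖g κ‖ ^ 2) / (4 * ‖L‖ ^ 2) := by
  have e : ∀ κ, ‖Asol dd db g L cc κ - cc / L ^ 2 * dd κ‖ ^ 2 = ‖projT dd db L g κ‖ ^ 2 / (4 * ‖L‖ ^ 2) := by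
    intro κ
    rw [Asol_eq_projT, add_sub_cancel_right, norm_div, norm_mul, Complex.norm_two, div_pow]
    ring
  rw [Finset.sum_congr rfl fun κ _ => e κ, ← Finset.sum_div]
  exact div_le_div_of_nonneg_right (sum_sq_projT_le hdb hL hL0 g) (by positivity)

/-- [folklore] **A3, ENTRYWISE**: `‖Asol_κ‖ ≤ ‖g‖₂/(2‖L‖) + ‖cc‖·‖∂_κ‖/‖L‖²` in the real zone. -/
theorem norm_Asol_le_real (hdb : ∀ κ, db κ = conj (dd κ)) (hL : dot db dd = L) (hL0 : L ≠ 0) (g : Fin D → ℂ) (cc : ℂ) (κ : Fin D) :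
    ‖Asol dd db g L cc κ‖ ≤ Real.sqrt (∑ l, ‖g l‖ ^ 2) / (2 * ‖L‖) + ‖cc‖ * ‖dd κ‖ / ‖L‖ ^ 2 := by
  refine (norm_Asol_le dd db g L cc κ).trans (add_le_add ?_ le_rfl)
  exact div_le_div_of_nonneg_right (norm_projT_le_real hdb hL hL0 g κ) (by positivity)

/-- [folklore] **A3, ENTRYWISE, SYMBOL-FREE FORM**: `‖Asol_κ‖ ≤ ‖g‖₂/(2‖L‖) + ‖cc‖/(‖L‖√‖L‖)` — the `|∂̂|⁻²` transverse entry plus the `|∂̂|⁻³`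
gauge-column entry. -/
theorem norm_Asol_le_real' (hdb : ∀ κ, db κ = conj (dd κ)) (hL : dot db dd = L) (hL0 : L ≠ 0) (g : Fin D → ℂ) (cc : ℂ) (κ : Fin D) :
    ‖Asol dd db g L cc κ‖ ≤ Real.sqrt (∑ l, ‖g l‖ ^ 2) / (2 * ‖L‖) + ‖cc‖ / (‖L‖ * Real.sqrt ‖L‖) := by
  refine (norm_Asol_le_real hdb hL hL0 g cc κ).trans (add_le_add le_rfl ?_)
  have hLpos : 0 < ‖L‖ := norm_pos_iff.mpr hL0
  have hspos : 0 < Real.sqrt ‖L‖ := Real.sqrt_pos.mpr hLpos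
  have hs : Real.sqrt ‖L‖ * Real.sqrt ‖L‖ = ‖L‖ := Real.mul_self_sqrt hLpos.le
  have e : ‖cc‖ / (‖L‖ * Real.sqrt ‖L‖) = ‖cc‖ * Real.sqrt ‖L‖ / ‖L‖ ^ 2 := by
    rw [div_eq_div_iff (mul_pos hLpos hspos).ne' (pow_pos hLpos 2).ne']
    calc ‖cc‖ * ‖L‖ ^ 2 = ‖cc‖ * ‖L‖ * (Real.sqrt ‖L‖ * Real.sqrt ‖L‖) := by rw [hs]; ring
      _ = ‖cc‖ * Real.sqrt ‖L‖ * (‖L‖ * Real.sqrt ‖L‖) := by ring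
  rw [e]
  gcongr
  exact norm_dd_le_sqrt hdb hL κ

/-- [folklore] **A3, MULTIPLIER ROW**: `‖musol‖ ≤ ‖g‖₂/(‖L‖√‖L‖)` in the real zone (the `|∂̂|⁻³` entry). -/
theorem norm_musol_le_real (hdb : ∀ κ, db κ = conj (dd κ)) (hL : dot db dd = L) (hL0 : L ≠ 0) (g : Fin D → ℂ) :
    ‖musol db g L‖ ≤ Real.sqrt (∑ l, ‖g l‖ ^ 2) / (‖L‖ * Real.sqrt ‖L‖) := by
  rw [norm_musol]
  have hLpos : 0 < ‖L‖ := norm_pos_iff.mpr hL0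
  have hspos : 0 < Real.sqrt ‖L‖ := Real.sqrt_pos.mpr hLpos
  have hs : Real.sqrt ‖L‖ * Real.sqrt ‖L‖ = ‖L‖ := Real.mul_self_sqrt hLpos.le
  rw [div_le_div_iff₀ (pow_pos hLpos 2) (mul_pos hLpos hspos)]
  calc ‖dot db g‖ * (‖L‖ * Real.sqrt ‖L‖)
      ≤ (Real.sqrt ‖L‖ * Real.sqrt (∑ l, ‖g l‖ ^ 2)) * (‖L‖ * Real.sqrt ‖L‖) := by
        gcongr
        exact norm_dot_le_real hdb hL g
    _ = Real.sqrt (∑ l, ‖g l‖ ^ 2) * (‖L‖ * (Real.sqrt ‖L‖ * Real.sqrt ‖L‖)) := by ring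
    _ = Real.sqrt (∑ l, ‖g l‖ ^ 2) * ‖L‖ ^ 2 := by rw [hs, sq]

/-- [folklore] **A3, MULTIPLIER ROW, SQUARE-ROOT FREE**: `‖musol‖² · ‖L‖³ ≤ Σ‖g_κ‖²`. -/
theorem sq_norm_musol_mul_le (hdb : ∀ κ, db κ = conj (dd κ)) (hL : dot db dd = L) (hL0 : L ≠ 0) (g : Fin D → ℂ) :
    ‖musol db g L‖ ^ 2 * ‖L‖ ^ 3 ≤ ∑ κ, ‖g κ‖ ^ 2 := by
  have hL' : ‖L‖ ≠ 0 := norm_ne_zero_iff.mpr hL0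
  have e : ‖musol db g L‖ ^ 2 * ‖L‖ ^ 3 = ‖dot db g‖ ^ 2 / ‖L‖ := by
    rw [norm_musol]
    field_simp
  rw [e]
  exact sq_norm_dot_le hdb hL hL0 g

end RealZone

/-! ### §4. The `FibreSymbols` instance: self-conjugate (real) fine momenta -/

section Symbols

variable (k : Fin D → ℂ)

/-- [folklore] The block datum of `FibreBlockSolve` at momentum `k` is the Laplacian symbol: `dot (∂̂♭(k)) (∂̂(k)) = lapSym k` (every complex `k`). -/
theorem dot_dflat_dhat : dot (dflat k) (dhat k) = lapSym k := by
  unfold dot lapSym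
  exact Finset.sum_congr rfl fun κ _ => mul_comm _ _

/-- [folklore] A real momentum vector, embedded by `B4Strip.ofRealVec`, is self-conjugate componentwise. -/
theorem conj_ofRealVec (p : Fin D → ℝ) (κ : Fin D) : conj (ofRealVec p κ) = ofRealVec p κ :=
  Complex.conj_ofReal _

/-- [folklore] IN THE REAL ZONE THE REFLECTED SYMBOL IS THE CONJUGATE SYMBOL: `∂̂♭_κ(k) = conj ∂̂_κ(k)` whenever `conj k_κ = k_κ` for all `κ`
(cf. the trigonometric forms `SymbolTaylor.dhat_ofRealVec` / `dflat_ofRealVec` of row P1-L07). -/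
theorem dflat_eq_conj_dhat (hk : ∀ κ, conj (k κ) = k κ) (κ : Fin D) : dflat k κ = conj (dhat k κ) := by
  simp only [dflat, dhat, map_sub, map_one, ← Complex.exp_conj, map_mul, Complex.conj_I, hk κ, neg_mul]

/-- [folklore] `lapSym k = Σ_κ ‖∂̂_κ(k)‖²` for self-conjugate `k` (`= Σ 4 sin²(k_κ/2)`, `SymbolTaylor.lapSym_ofRealVec`, whose two-sided bounds are row P1-L07's). -/
theorem lapSym_eq_sum_sq (hk : ∀ κ, conj (k κ) = k κ) : lapSym k = ((∑ κ, ‖dhat k κ‖ ^ 2 : ℝ) : ℂ) := by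
  rw [← dot_dflat_dhat]
  exact L_eq_sum_sq (dflat_eq_conj_dhat k hk) rfl

/-- [folklore] `‖lapSym k‖ = Σ_κ ‖∂̂_κ(k)‖²` for self-conjugate `k`. -/
theorem norm_lapSym (hk : ∀ κ, conj (k κ) = k κ) : ‖lapSym k‖ = ∑ κ, ‖dhat k κ‖ ^ 2 :=
  norm_L (dflat_eq_conj_dhat k hk) (dot_dflat_dhat k)

/-- [folklore] Each symbol component is at most `√‖lapSym k‖` (self-conjugate `k`). -/
theorem norm_dhat_le_sqrt (hk : ∀ κ, conj (k κ) = k κ) (κ : Fin D) : ‖dhat k κ‖ ≤ Real.sqrt ‖lapSym k‖ :=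
  norm_dd_le_sqrt (dflat_eq_conj_dhat k hk) (dot_dflat_dhat k) κ

/-- [folklore] **A3 AT A REAL FINE MOMENTUM, `ℓ²`**: for self-conjugate `k` with `lapSym k ≠ 0` (i.e. `k ∉ 2πℤ^D`), feeds `g`, `cc`, `L = lapSym k`:
`Σ_κ ‖Asol_κ‖² ≤ Σ‖g_κ‖²/(4‖L‖²) + ‖cc‖²/‖L‖³`. -/
theorem sum_sq_Asol_symbol_le (hk : ∀ κ, conj (k κ) = k κ) (hL0 : lapSym k ≠ 0) (g : Fin D → ℂ) (cc : ℂ) :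
    ∑ κ, ‖Asol (dhat k) (dflat k) g (lapSym k) cc κ‖ ^ 2 ≤ (∑ κ, ‖g κ‖ ^ 2) / (4 * ‖lapSym k‖ ^ 2) + ‖cc‖ ^ 2 / ‖lapSym k‖ ^ 3 :=
  sum_sq_Asol_le (dflat_eq_conj_dhat k hk) (dot_dflat_dhat k) hL0 g cc

/-- [folklore] **A3 AT A REAL FINE MOMENTUM, ENTRYWISE**: `‖Asol_κ‖ ≤ ‖g‖₂/(2‖L‖) + ‖cc‖/(‖L‖√‖L‖)`, `L = lapSym k ≠ 0`. -/
theorem norm_Asol_symbol_le (hk : ∀ κ, conj (k κ) = k κ) (hL0 : lapSym k ≠ 0) (g : Fin D → ℂ) (cc : ℂ) (κ : Fin D) :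
    ‖Asol (dhat k) (dflat k) g (lapSym k) cc κ‖
      ≤ Real.sqrt (∑ l, ‖g l‖ ^ 2) / (2 * ‖lapSym k‖) + ‖cc‖ / (‖lapSym k‖ * Real.sqrt ‖lapSym k‖) :=
  norm_Asol_le_real' (dflat_eq_conj_dhat k hk) (dot_dflat_dhat k) hL0 g cc κ

/-- [folklore] **A3 AT A REAL FINE MOMENTUM, MULTIPLIER**: `‖musol‖ ≤ ‖g‖₂/(‖L‖√‖L‖)`, `L = lapSym k ≠ 0`. -/
theorem norm_musol_symbol_le (hk : ∀ κ, conj (k κ) = k κ) (hL0 : lapSym k ≠ 0) (g : Fin D → ℂ) :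
    ‖musol (dflat k) g (lapSym k)‖ ≤ Real.sqrt (∑ l, ‖g l‖ ^ 2) / (‖lapSym k‖ * Real.sqrt ‖lapSym k‖) :=
  norm_musol_le_real (dflat_eq_conj_dhat k hk) (dot_dflat_dhat k) hL0 g

/-- [folklore] LONGITUDINAL CONTENT at any momentum with `lapSym k ≠ 0`: `‖∂̂♭·Asol‖ = ‖cc‖/‖lapSym k‖`. -/
theorem norm_dot_Asol_symbol (hL0 : lapSym k ≠ 0) (g : Fin D → ℂ) (cc : ℂ) :
    ‖dot (dflat k) (Asol (dhat k) (dflat k) g (lapSym k) cc)‖ = ‖cc‖ / ‖lapSym k‖ :=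
  norm_dot_Asol (dhat k) (dflat k) g hL0 (dot_dflat_dhat k) cc

end Symbols

end Summit.QuantumFields.BalabanUV.Beta.GAN24.FibreBlockBounds

end
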